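import Summits.QuantumFields.YangMills.Theorems.BalabanUVNodesN06Row17LocalCentreTwoLevelOfLev
import Literature.MathematicalPhysics.QuantumFieldTheory.Balaban1983to89.B9LocalCubeGeometryTwoLevelWindowY

/-!
# BalabanUVNodes ∕ N06 ([B9], `Dag.B9_main`) — ROW 17's LOCAL CENTRE NUMBER `m_□` AND LOCAL CLAUSE AT EVERY ENLARGED CUBE `□̃(c)` OF THE COVER:
# the `hco` binder of the local road at `U = 1` and `hloc(U)` on print's class (3.35), the level window `{j, j+1}` and the two-block collar condition of
# `…LocalCentreTwoLevelOfLev` DISCHARGED by the separation (2.2) (`B9LocalCubeGeometryTwoLevelWindowY.exists_twoLevel_window_cubeDomY`)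

Track A of `YM-PLAN.md` (cell `pub-ymgap`, HUMAN RULING D-0062), node **N06** = [Balaban1985BackgroundPropagators] Thms 3.1–3.15; seat `pub-ymgap-dag-n06-j`
(bundle F5, rows 15–17), g26.  A HELPER (count-neutral, `--supports` only).

THE PRINT.  [B9] p. 416 (proof of Thm 3.11): *«In [4] we have proved that the operator G_□(1) is positive»*; [4] = [Balaban1984PropagatorsII] (2.2) p. 224:
*«(Lʲη)⁻¹ dist(Ω_jᶜ, Ω_{j+1}) > RM»*, (2.89) p. 239: *«B^j(Λ) = □̃ ∩ B^{j+1}(Λ_{j+1})»*, Lemma 2.4 (2.128) p. 245.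

WHAT.  g25 (`…LocalCentreTwoLevelOfLev.coer_trIP_padDeltaALocY_one_cubeDomY_of_twoLevel_unif` ∕ `posDefTr_padDeltaALocY_of_L5_of_regYP335_twoLevel_unif`) gave the
two faces for a cube whose fine sites have levels in a DISPLAYED window `{j, j+1}` (`h2`) with a DISPLAYED two-block collar condition (`hNbr2`).  This seat's Literature
`B9LocalCubeGeometryTwoLevelWindowY.exists_twoLevel_window_cubeDomY` PROVES both for every cover cube at every member, with `j ∈ {j(c) − 1, j(c)}`, from the member's
`R ≥ 2L²` alone.  THIS FILE composes:
* ★★★ `coer_trIP_padDeltaALocY_one_cubeDomY_of_margins` — for EVERY member `x` and EVERY cover cube `c`, given only the label margins of the blocks at and around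
  `□̃(c)` at the two candidate levels `j ∈ {j(c) − 1, j(c)}` (`hmargS`, `hmargT` — cubes off the torus chart's seam), `0 < b₀`, and 0∕1 cuts with `χ` issuing from
  `□̃(c)`: **`min 1 γ₂(k−1) · ⟨Ψ,Ψ⟩₁ ≤ ⟨Ψ, padDeltaALocY x.toKIdx parSymY parBY (cubeDomY x c) (cutMulY χP) (cutMulY χ) 1 Ψ⟩₁` for EVERY `Ψ`** — the `hco` binder of the
  road of record at `U = 1` with the member-uniform `m_□ = min 1 γ₂(k−1)`.
* ★★★ `posDefTr_padDeltaALocY_of_L5_of_regYP335_of_margins` — `hloc(U)` on (3.35) at every cube from L5's pencil letters, the fibre count, the radius inequalities at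
  `m_□ = min 1 γ₂(k−1)` and the (3.35) comparison, under the same margins.
HONEST FRAMING.  Compositions over landed files; the label margins (cubes off the chart's seam) stay DISPLAYED geometric facts; L5's analytic letters stay displayed;
constants dag-n10-c's; COUNT-NEUTRAL; N06 ∕ N10 NOT discharged; nothing continuum ∕ OS ∕ mass gap ∕ Clay.  0 `def`, 0 `sorry`.
-/

noncomputable section

namespace Summit.QuantumFields.YangMills.BalabanUVNodes.N06Row17LocalCentreEveryCube

open Finset
open Literature.MathematicalPhysics.QuantumFieldTheory.Balaban1983to89
open Literature.MathematicalPhysics.QuantumFieldTheory.Balaban1983to89.Node00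
open Literature.MathematicalPhysics.QuantumFieldTheory.Balaban1983to89.Node00.OpsYDeltaALocal (padDeltaALocY)
open Literature.MathematicalPhysics.QuantumFieldTheory.Balaban1983to89.B9Thm311ReadingCoords (trIP PosDefTr)
open Literature.MathematicalPhysics.QuantumFieldTheory.Balaban1983to89.B9Thm37CubeCoverCommutators (cutMulY)
open Literature.MathematicalPhysics.QuantumFieldTheory.Balaban1983to89.B6KLevelCensusIndexV1 (KIdx kGeo)
open Literature.MathematicalPhysics.QuantumFieldTheory.Balaban1983to89.B6GlobalChartV1 (PV domT toBox boxEquiv)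
open Literature.MathematicalPhysics.QuantumFieldTheory.Balaban1983to89.B5Eq118OneStroke (iterBlock iterBlockOf)
open Literature.MathematicalPhysics.QuantumFieldTheory.Balaban1983to89.Node00.OpsYNablaBridge (chartY)
open Literature.MathematicalPhysics.QuantumFieldTheory.Balaban1983to89.B9BackgroundsKLevelV1 (CfgV1)
open Literature.MathematicalPhysics.QuantumFieldTheory.Balaban1983to89.B9BackgroundsKLevelV1P (bg9YP)
open Literature.MathematicalPhysics.QuantumFieldTheory.Balaban1983to89.B9PinMembersKLevelV1 (MemberY)
open Literature.MathematicalPhysics.QuantumFieldTheory.Balaban1983to89.B6Cover236MultiLevelBlocks (cubes)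
open Literature.MathematicalPhysics.QuantumFieldTheory.Balaban1983to89.B9WalkLettersCoordsS (cubeDomY)
open Literature.MathematicalPhysics.QuantumFieldTheory.Balaban1983to89.LatticeNorms (scaleLen)
open Literature.MathematicalPhysics.QuantumFieldTheory.Balaban1983to89.B5TorusCover (UT)
open Literature.MathematicalPhysics.QuantumFieldTheory.Balaban1983to89.B13EntrywiseWalks (RawEntryLetters)
open Literature.MathematicalPhysics.QuantumFieldTheory.Balaban1983to89.B9Eq39Adjoint (prodCfg)
open Literature.MathematicalPhysics.QuantumFieldTheory.Balaban1983to89.B9LocalCubeGeometryTwoLevelWindowY (exists_twoLevel_window_cubeDomY)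
open Summit.QuantumFields.YangMills.BalabanUVNodes.N06Row17LocalCentreTwoLevelOfLev
  (coer_trIP_padDeltaALocY_one_cubeDomY_of_twoLevel_unif posDefTr_padDeltaALocY_of_L5_of_regYP335_twoLevel_unif)
open scoped Matrix
open scoped Matrix.Norms.L2Operator

variable {N : ℕ} {d ℓ : ℕ} {hd : 1 ≤ d + 1} {hL : Odd (ℓ + 1) ∧ 1 < ℓ + 1} {b₀ b₁ : ℝ} {Mstar : ℕ}
variable {ν : ℕ} {Nf : Fin ν → ℕ} [∀ j, NeZero (Nf j)]

/-- ★★★ **ROW 17's LOCAL CENTRE NUMBER AT EVERY ENLARGED CUBE `□̃(c)`, `U = 1`, MEMBER-UNIFORM CONSTANT.**  For EVERY member `x` and EVERY cover cube `c`: given the label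
margins of one big block off the box boundary for the `Λ_j`-blocks inside `□̃(c)` (`hmargS`) and for the `Λ_{j+1}`-blocks one step around a scale-`(j+1)` block meeting
`□̃(c)` (`hmargT`) at the two candidate levels `j ∈ {j(c) − 1, j(c)}`, `0 < b₀`, and 0∕1 cuts `χP`, `χ` with `χ` issuing from `□̃(c)`:
**`min 1 γ₂(k−1) · ⟨Ψ,Ψ⟩₁ ≤ ⟨Ψ, padDeltaALocY x.toKIdx parSymY parBY (cubeDomY x c) (cutMulY χP) (cutMulY χ) 1 Ψ⟩₁` for EVERY `Ψ`** — the level window `{j, j+1}` of `□̃(c)`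
and the two-block collar condition are THEOREMS (`exists_twoLevel_window_cubeDomY`, from `2L² ≤ R`), fed to `…_of_twoLevel_unif`.
[cite: Balaban1985BackgroundPropagators, Thm 3.11 proof p.416, Cor. 3.6 p.408, pp.408–409 (G_□, □̃); Balaban1984PropagatorsII, (2.2) p.224, (2.89) p.239, Lemma 2.4 (2.128) p.245] -/
theorem coer_trIP_padDeltaALocY_one_cubeDomY_of_margins (x : MemberY d ℓ hd hL b₀ b₁ Mstar) (c : ↥(cubes x.toKIdx.D.toDomains)) (hd2 : 2 ≤ d + 1)
    (hmargS : ∀ j : ℕ, (j = c.1.1 ∨ j + 1 = c.1.1) → ∀ y : Site (PV d ℓ x.m x.K hd hL) j, (domT x.toKIdx.hN x.toKIdx.D x.toKIdx.hk).LamSite j y →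
      (∃ y' ∈ iterBlock j y, chartY x.toKIdx y' ∈ cubeDomY x c) →
      ∀ μ, (ℓ + 1) ^ (j + 1) ≤ (y μ).val * (ℓ + 1) ^ j ∧ (y μ).val * (ℓ + 1) ^ j + (ℓ + 1) ^ j + (ℓ + 1) ^ (j + 1) ≤ (PV d ℓ x.m x.K hd hL).sitesPerDir 0)
    (hmargT : ∀ j : ℕ, (j = c.1.1 ∨ j + 1 = c.1.1) → ∀ Y : Site (PV d ℓ x.m x.K hd hL) (j + 1), (domT x.toKIdx.hN x.toKIdx.D x.toKIdx.hk).LamSite (j + 1) Y →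
      (∃ Y₀ : Site (PV d ℓ x.m x.K hd hL) (j + 1), (∃ y : Site (PV d ℓ x.m x.K hd hL) 0, iterBlockOf (j + 1) y = Y₀ ∧ chartY x.toKIdx y ∈ cubeDomY x c) ∧
        (Y = Y₀ ∨ ∃ μ, Y = Y₀.shift μ ∨ Y₀ = Y.shift μ)) →
      ∀ μ, (ℓ + 1) ^ (j + 1) ≤ (Y μ).val * (ℓ + 1) ^ (j + 1) ∧ (Y μ).val * (ℓ + 1) ^ (j + 1) + 2 * (ℓ + 1) ^ (j + 1) ≤ (PV d ℓ x.m x.K hd hL).sitesPerDir 0)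
    (hb₀ : 0 < b₀) {χP : BlkY x.toKIdx → ℝ} (hχP : ∀ y, χP y = 0 ∨ χP y = 1) {χ : FBondY x.toKIdx → ℝ} (hχ : ∀ b, χ b = 0 ∨ χ b = 1)
    (hχD : ∀ b, χ b ≠ 0 → chartY x.toKIdx b.src ∈ cubeDomY x c) (Ψ : FBondY x.toKIdx → Matrix (Fin N) (Fin N) ℂ) :
    min 1 (2 / ((12 * (((d + 1 : ℕ) : ℝ)) ^ 2 * (1 + 12 * (((d + 1 : ℕ) : ℝ)) * ((((ℓ + 1 : ℕ) : ℝ)) ^ (x.toKIdx.k - 1)) ^ 2))⁻¹ *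
              (((((ℓ + 1 : ℕ) : ℝ)) ^ (x.toKIdx.k - 1 + 1)) ^ (d + 1 + 1))⁻¹ *
                min (x.toKIdx.cf ^ 2 / 2) (b₀ * x.toKIdx.cf ^ 2 / ((((ℓ + 1 : ℕ) : ℝ)) ^ (x.toKIdx.k - 1 + 1)) ^ (d + 1 - 2))) +
          4 / (8 * x.toKIdx.cf ^ 2 / ((((ℓ + 1 : ℕ) : ℝ)) ^ x.toKIdx.k) ^ 2) *
            (1 + 4 * ((d + 1 : ℕ) : ℝ) * x.toKIdx.cf ^ 2 /
              ((12 * (((d + 1 : ℕ) : ℝ)) ^ 2 * (1 + 12 * (((d + 1 : ℕ) : ℝ)) * ((((ℓ + 1 : ℕ) : ℝ)) ^ (x.toKIdx.k - 1)) ^ 2))⁻¹ *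
                (((((ℓ + 1 : ℕ) : ℝ)) ^ (x.toKIdx.k - 1 + 1)) ^ (d + 1 + 1))⁻¹ *
                  min (x.toKIdx.cf ^ 2 / 2) (b₀ * x.toKIdx.cf ^ 2 / ((((ℓ + 1 : ℕ) : ℝ)) ^ (x.toKIdx.k - 1 + 1)) ^ (d + 1 - 2)))))⁻¹ *
        trIP (fun _ => (1 : ℝ)) Ψ Ψ ≤
      trIP (fun _ => (1 : ℝ)) Ψ
        (padDeltaALocY x.toKIdx (parSymY x.toKIdx) (parBY x.toKIdx) (cubeDomY x c) (cutMulY χP) (cutMulY χ)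
          (fun _ _ => 1 : CfgY (Matrix (Fin N) (Fin N) ℂ) x.toKIdx) Ψ) := by
  obtain ⟨j, hjk, hjc, h2, hNbr2⟩ := exists_twoLevel_window_cubeDomY x c
  exact coer_trIP_padDeltaALocY_one_cubeDomY_of_twoLevel_unif x c hd2 hjk h2 hNbr2 (hmargS j hjc) (hmargT j hjc) hb₀ hχP hχ hχD Ψ

/-- ★★★ **ROW 17's LOCAL CLAUSE ON (3.35) AT EVERY ENLARGED CUBE `□̃(c)`, MEMBER-UNIFORM CENTRE NUMBER**: `hloc(U)` for `U` in print's class from L5's pencil letters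
`hA`, the fibre count `hfib`, the radius inequalities `hR′ hR′R`, `hsmall` at `m_□ = min 1 γ₂(k−1)` and the (3.35) comparison `hCr` — for EVERY cover cube, given only the
label margins at the two candidate levels `j ∈ {j(c) − 1, j(c)}`, 0∕1 cuts with `χ` issuing from `□̃(c)`, `0 < b₀` (the level window and the collar condition of
`…_twoLevel_unif` are theorems). [cite: Balaban1985BackgroundPropagators, Thm 3.11 proof p.416, Cor. 3.6 p.408, (3.35) p.396, pp.408–410; Balaban1984PropagatorsII, (2.2) p.224, (2.89) p.239, Lemma 2.4 (2.128) p.245; Balaban1988RG2Cluster, p.15] -/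
theorem posDefTr_padDeltaALocY_of_L5_of_regYP335_of_margins [Nonempty (Fin N)] {G : Subgroup (Matrix (Fin N) (Fin N) ℂ)ˣ}
    (x : MemberY d ℓ hd hL b₀ b₁ Mstar) (c : ↥(cubes x.toKIdx.D.toDomains)) {χP : BlkY x.toKIdx → ℝ} (hχP : ∀ y, χP y = 0 ∨ χP y = 1)
    {χ : FBondY x.toKIdx → ℝ} (hχ : ∀ b, χ b = 0 ∨ χ b = 1) (hχD : ∀ b, χ b ≠ 0 → boxEquiv x.toKIdx.hN b.src ∈ cubeDomY x c)
    (hd2 : 2 ≤ d + 1)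
    (hmargS : ∀ j : ℕ, (j = c.1.1 ∨ j + 1 = c.1.1) → ∀ y : Site (PV d ℓ x.m x.K hd hL) j, (domT x.toKIdx.hN x.toKIdx.D x.toKIdx.hk).LamSite j y →
      (∃ y' ∈ iterBlock j y, chartY x.toKIdx y' ∈ cubeDomY x c) →
      ∀ μ, (ℓ + 1) ^ (j + 1) ≤ (y μ).val * (ℓ + 1) ^ j ∧ (y μ).val * (ℓ + 1) ^ j + (ℓ + 1) ^ j + (ℓ + 1) ^ (j + 1) ≤ (PV d ℓ x.m x.K hd hL).sitesPerDir 0)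
    (hmargT : ∀ j : ℕ, (j = c.1.1 ∨ j + 1 = c.1.1) → ∀ Y : Site (PV d ℓ x.m x.K hd hL) (j + 1), (domT x.toKIdx.hN x.toKIdx.D x.toKIdx.hk).LamSite (j + 1) Y →
      (∃ Y₀ : Site (PV d ℓ x.m x.K hd hL) (j + 1), (∃ y : Site (PV d ℓ x.m x.K hd hL) 0, iterBlockOf (j + 1) y = Y₀ ∧ chartY x.toKIdx y ∈ cubeDomY x c) ∧
        (Y = Y₀ ∨ ∃ μ, Y = Y₀.shift μ ∨ Y₀ = Y.shift μ)) →
      ∀ μ, (ℓ + 1) ^ (j + 1) ≤ (Y μ).val * (ℓ + 1) ^ (j + 1) ∧ (Y μ).val * (ℓ + 1) ^ (j + 1) + 2 * (ℓ + 1) ^ (j + 1) ≤ (PV d ℓ x.m x.K hd hL).sitesPerDir 0)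
    (hb₀ : 0 < b₀)
    {cthr α₀ : ℝ} (hc : cthr ≤ 10) (hα : 0 ≤ α₀) {U : CfgV1 (PV d ℓ x.m x.K hd hL) (Matrix (Fin N) (Fin N) ℂ)}
    (hreg : (bg9YP (Matrix (Fin N) (Fin N) ℂ) G x).Reg335 cthr α₀ U)
    {loc : FBondY x.toKIdx × (Fin N × Fin N) → UT Nf} {R R' ρ B : ℝ}
    (hA : RawEntryLetters (fun a : Fin (d + 1) → Site (PV d ℓ x.m x.K hd hL) 0 → Matrix (Fin N) (Fin N) ℂ =>
      LinearMap.toMatrix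
        ((Pi.basis fun _ : FBondY x.toKIdx => Matrix.stdBasis ℂ (Fin N) (Fin N)).reindex (Equiv.sigmaEquivProd (FBondY x.toKIdx) (Fin N × Fin N)))
        ((Pi.basis fun _ : FBondY x.toKIdx => Matrix.stdBasis ℂ (Fin N) (Fin N)).reindex (Equiv.sigmaEquivProd (FBondY x.toKIdx) (Fin N × Fin N)))
        (padDeltaALocY x.toKIdx (parSymY x.toKIdx) (parBY x.toKIdx) (cubeDomY x c) (cutMulY χP) (cutMulY χ)
          (prodCfg (1 : CfgY (Matrix (Fin N) (Fin N) ℂ) x.toKIdx) (kGeo x.toKIdx).eta a))) loc R ρ B)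
    (hρ : 0 < ρ) {mF : ℕ} (hfib : ∀ y : UT Nf, (univ.filter fun k => loc k = y).card ≤ mF)
    (hR' : 0 < R') (hR'R : R' ≤ R)
    (hsmall : 2 * (B * (mF * B6.c0 1 ρ ^ ν)) * R' <
      min 1 (2 / ((12 * (((d + 1 : ℕ) : ℝ)) ^ 2 * (1 + 12 * (((d + 1 : ℕ) : ℝ)) * ((((ℓ + 1 : ℕ) : ℝ)) ^ (x.toKIdx.k - 1)) ^ 2))⁻¹ *
                (((((ℓ + 1 : ℕ) : ℝ)) ^ (x.toKIdx.k - 1 + 1)) ^ (d + 1 + 1))⁻¹ *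
                  min (x.toKIdx.cf ^ 2 / 2) (b₀ * x.toKIdx.cf ^ 2 / ((((ℓ + 1 : ℕ) : ℝ)) ^ (x.toKIdx.k - 1 + 1)) ^ (d + 1 - 2))) +
            4 / (8 * x.toKIdx.cf ^ 2 / ((((ℓ + 1 : ℕ) : ℝ)) ^ x.toKIdx.k) ^ 2) *
              (1 + 4 * ((d + 1 : ℕ) : ℝ) * x.toKIdx.cf ^ 2 /
                ((12 * (((d + 1 : ℕ) : ℝ)) ^ 2 * (1 + 12 * (((d + 1 : ℕ) : ℝ)) * ((((ℓ + 1 : ℕ) : ℝ)) ^ (x.toKIdx.k - 1)) ^ 2))⁻¹ *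
                  (((((ℓ + 1 : ℕ) : ℝ)) ^ (x.toKIdx.k - 1 + 1)) ^ (d + 1 + 1))⁻¹ *
                    min (x.toKIdx.cf ^ 2 / 2) (b₀ * x.toKIdx.cf ^ 2 / ((((ℓ + 1 : ℕ) : ℝ)) ^ (x.toKIdx.k - 1 + 1)) ^ (d + 1 - 2)))))⁻¹ * R)
    (hCr : 2 * (kGeo x.toKIdx).L ^ 4 * ((kGeo x.toKIdx).M * α₀) * (scaleLen (kGeo x.toKIdx).L (kGeo x.toKIdx).eta c.1.1)⁻¹ ≤ R') :
    PosDefTr (fun _ => (1 : ℝ)) (padDeltaALocY x.toKIdx (parSymY x.toKIdx) (parBY x.toKIdx) (cubeDomY x c) (cutMulY χP) (cutMulY χ) U) := by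
  obtain ⟨j, hjk, hjc, h2, hNbr2⟩ := exists_twoLevel_window_cubeDomY x c
  exact posDefTr_padDeltaALocY_of_L5_of_regYP335_twoLevel_unif x c hχP hχ hχD hd2 hjk h2 hNbr2 (hmargS j hjc) (hmargT j hjc) hb₀ hc hα hreg hA hρ
    hfib hR' hR'R hsmall hCr

end Summit.QuantumFields.YangMills.BalabanUVNodes.N06Row17LocalCentreEveryCube

end
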